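import Summits.QuantumFields.BalabanUV.T4Continuum.Support.NE7AllMinimisersCubeReg910Full
import Summits.QuantumFields.BalabanUV.T4Continuum.Support.NE7MinimalOrbitUniqueGeneric
import HarnessLib

/-!
# NE7B11Thm1ForMinimisers — [Balaban1985Variational] THEOREM 1 (TYPE) FOR THE CONSTRAINED SMALL-FIELD MINIMISERS OF ROW NE7, IN ONE DECLARATION: for every `U(n)`, `L ≥ 2`, every
# small `ε`, every coarse torus `N` and every small datum `V`, at every level `k` (`M = L^k`): (8) a minimiser of the level-`k` constrained problem over `sfClass` EXISTS and is interior;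
# its orbit is UNIQUE (all minimisers are unitary periodic gauge copies of one); and EVERY minimiser has, about every point, a local Landau chart with (9)₁ `‖A‖ ≤ C₀ε∕M`, (9)₂
# `‖∇A‖ ≤ C₁ε∕M²`, (10) `‖ΔA‖, ‖∂*∂A‖ ≤ C₂ε∕M³`, (9)₃ `‖∇A(z₁) − ∇A(z₂)‖ ≤ C₃(1+(1−β)⁻¹)εh^β∕M^{2+β}` for every `β < 1` — constants depending on `L` and `card n` only
# (capstone of the lineage's print-fidelity programme; gen 112)

Cell `pub-balaban`, rung (B)+1 sub-cell t4, lineage `b2b-balaban-t4-ne7-p1` (CRUX PROVER NE7 #1 = OWNER of BINDER row NE7), generation 112.  Memo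
`t4/b2b-balaban-t4-ne7-p1-g112/ROAD-G112.md`.  BY NAME over gen 109's ✓ p810221 `NE7HintUnconditionalGeneric.hint_small_data_generic` ((8)∃, interior), ✓ p810527
`NE7MinimalOrbitUniqueGeneric.minimal_orbit_unique_generic` (uniqueness of the minimal orbit), and gen 112's ✓ `NE7AllMinimisersCubeReg910Full.all_minimisers_cube_reg910_full`
((9)∕(10)).  A composition: the three smallness thresholds `ε₀` and the three data radii `δ_V` are replaced by their minima (`MinimalActionRate.SmallField.mono`).
WHAT (**`b11_thm1_sfClass`**, 0 def, 0 sorry; `d = 4`, every `U(n)`, every `L ≥ 2`).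
DICTIONARY WITH PRINT (Thm 1 p. 279).  Print: constants `a₀, a₁, B₃, B₄(β₀), M(ε₁)`; «for an arbitrary configuration V satisfying (7) with ε₁ ≤ a₁ there exists a minimal orbit in the space
𝔘_k({Ω_j}, B₃ε₁) ∩ 𝔅_k(𝔅_k, V) (8). This orbit is a unique critical orbit in the space (6) if B₃ε₁ ≤ ε₀ ≤ a₀. The minimal configurations U have the regularity properties (9), (10) on cubes
□ of size 2ML^jη, M ≤ M(ε₁), in a gauge u defined on a neighborhood of □».  Ours: the everywhere-small-field case (`Ω_j = T`, top scale), the class `sfClass 4 L N ε k` = the space (6)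
with radius `ε∕M²`, data `V` in the small data of radius `δ_V(n, L, ε, N)`; «minimal orbit exists» = (8)∃ (interior); «unique» = uniqueness of the MINIMAL orbit (print's stronger
«unique CRITICAL orbit in (6)» is NOT claimed); (9)∕(10) on the physical cube of size ≈ 2 about every point (print: size `2M(ε₁)`), the Hölder clause for every `β < 1` with
`B₄ ∝ (1−β)⁻¹` (print: `β₀ = 1` — NOT reached: junction logarithm, ROAD-G110 §4).
HONEST FRAMING (page 1): OUR minimisers, OUR route (gens 20–112 of this lineage + the co-owner lineage's (156)–(162) + row NE3's tangent calculus); nothing of Bałaban's asserted and NOT his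
method (Sect. A induction, regular spaces); NOT the typed `B11Thm1.Thm1At` by name (r2's abstract carrier); NE7 as a spine node remains the dagwriter∕referees' call; spine 0∕9; finite T⁴
rung (B)+1 — NOT infinite volume, NOT mass gap, NOT BetaPertH, NOT Clay (continuum YM on T⁴ ⇐ BetaPertH ∧ nine spine estimates).
-/

set_option autoImplicit false

open NormedSpace
open scoped BigOperators Matrix Matrix.Norms.L2Operator
open Finset

namespace Summit.QuantumFields.BalabanUV.T4Continuum.NE7B11Thm1ForMinimisers

open Literature.MathematicalPhysics.QuantumFieldTheory.Balaban1983to89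
open B7Prop1Explicit B7Prop2Explicit
open T4AveragingDeficitWall (SmallField IsUnitaryCfg)
open T4AveragingDeficitWallBoundary (IsPeriodicCfg)
open Beta.PoissonInterior (cube supNorm)
open MinimalActionSandwich (IsMinimiser)
open MinimalActionRate (sfClass)
open NE3EnergyShapes (IsUnitarySite IsPeriodicSite)
open NE7HintUnconditionalGeneric (hint_small_data_generic)
open NE7MinimalOrbitUniqueGeneric (minimal_orbit_unique_generic)
open NE7AllMinimisersCubeReg910Full (all_minimisers_cube_reg910_full)

noncomputable section

variable {n : Type} [Fintype n] [DecidableEq n] [Nonempty n]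

/-- **[Balaban1985Variational] THEOREM 1 (TYPE) FOR THE CONSTRAINED SMALL-FIELD MINIMISERS — existence (8), uniqueness of the minimal orbit, regularity (9)₁₂₃^{β<1} ∧ (10)** — see
the module docstring for the dictionary with print and the honest framing. [folklore] -/
theorem b11_thm1_sfClass {L : ℕ} (hL : 2 ≤ L) :
    ∃ C₀ C₁ C₂ C₃ : ℝ, 0 ≤ C₀ ∧ 0 ≤ C₁ ∧ 0 ≤ C₂ ∧ 0 ≤ C₃ ∧ ∃ ε₀ : ℝ, 0 < ε₀ ∧ ∀ ε : ℝ, 0 < ε → ε ≤ ε₀ → ∀ (N : ℕ) [NeZero N], 1 ≤ N →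
      ∃ δV : ℝ, 0 < δV ∧
        ∀ V ∈ {V : Site 4 → Fin 4 → (Matrix n n ℂ)ˣ | IsUnitaryCfg V ∧ IsPeriodicCfg V (N : ℤ) ∧ SmallField V δV}, ∀ k : ℕ,
        -- (8): a minimiser exists, with plaquettes STRICTLY inside the class radius
        (∃ U : Site 4 → Fin 4 → (Matrix n n ℂ)ˣ, IsMinimiser 4 (sfClass 4 L N ε) L N k V U ∧
          ∃ a : ℝ, 0 ≤ a ∧ a < ε / ((L : ℝ) ^ k) ^ 2 ∧ SmallField U a) ∧
        -- uniqueness of the minimal orbit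
        (∃ Us : Site 4 → Fin 4 → (Matrix n n ℂ)ˣ, IsMinimiser 4 (sfClass 4 L N ε) L N k V Us ∧
          ∀ U' : Site 4 → Fin 4 → (Matrix n n ℂ)ˣ, IsMinimiser 4 (sfClass 4 L N ε) L N k V U' →
            ∃ u : Site 4 → (Matrix n n ℂ)ˣ, IsUnitarySite u ∧ IsPeriodicSite u ((N * L ^ k : ℕ) : ℤ) ∧ gaugeAct u U' = Us) ∧
        -- (9), (10) for every minimiser about every point
        (∀ U : Site 4 → Fin 4 → (Matrix n n ℂ)ˣ, IsMinimiser 4 (sfClass 4 L N ε) L N k V U → ∀ z : Site 4,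
          ∃ (u : Site 4 → (Matrix n n ℂ)ˣ) (A : Site 4 → Fin 4 → Matrix n n ℂ), (∀ x, u x ∈ unitaryUnits (Matrix n n ℂ)) ∧
            (∀ (x : Site 4) (κ : Fin 4), (∀ i, |x i - z i| ≤ ((16 * L ^ k + 5 : ℕ) : ℤ)) → gaugeAct u U x κ = expUnit (A x κ)) ∧
            (∀ (x : Site 4) (κ : Fin 4), (∀ i, |x i - z i| ≤ ((16 * L ^ k + 5 : ℕ) : ℤ)) → A x κ ∈ skewAdjoint (Matrix n n ℂ)) ∧
            (∀ (x : Site 4) (κ : Fin 4), (∀ i, |x i - z i| ≤ ((16 * L ^ k + 5 : ℕ) : ℤ)) → ‖A x κ‖ ≤ C₀ * ε / (L : ℝ) ^ k) ∧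
            (∀ x : Site 4, 2 * supNorm (x - z) ≤ 16 * L ^ k → ∀ κ τ : Fin 4, ‖A (x + e τ) κ - A x κ‖ ≤ C₁ * ε / ((L : ℝ) ^ k) ^ 2) ∧
            (∀ y : Site 4, supNorm (y - z) ≤ 7 * L ^ k → ∀ ν : Fin 4,
              ‖∑ i, ((A (y + e i) ν - A y ν) - (A y ν - A (y - e i) ν))‖ ≤ C₂ * ε / ((L : ℝ) ^ k) ^ 3) ∧
            (∀ y : Site 4, supNorm (y - z) ≤ 7 * L ^ k → ∀ ν : Fin 4,
              ‖∑ μ, ((A y μ + A (y + e μ) ν - A (y + e ν) μ - A y ν)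
                      - (A (y - e μ) μ + A (y - e μ + e μ) ν - A (y - e μ + e ν) μ - A (y - e μ) ν))‖ ≤ C₂ * ε / ((L : ℝ) ^ k) ^ 3) ∧
            (∀ β : ℝ, 0 ≤ β → β < 1 → ∀ z₁ z₂ : Site 4, z₁ ∈ cube z (L ^ k - 1) → z₂ ∈ cube z (L ^ k - 1) → ∀ μ κ : Fin 4,
              ‖(A (z₁ + e μ) κ - A z₁ κ) - (A (z₂ + e μ) κ - A z₂ κ)‖
                ≤ C₃ * (1 + (1 - β)⁻¹) * ε * (supNorm (z₁ - z₂) : ℝ) ^ β / ((L : ℝ) ^ k) ^ (2 + β))) := by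
  obtain ⟨ε₁, hε₁, H1⟩ := hint_small_data_generic (n := n) hL
  obtain ⟨ε₂, hε₂, H2⟩ := minimal_orbit_unique_generic (n := n) hL
  obtain ⟨C₀, C₁, C₂, C₃, hC₀, hC₁, hC₂, hC₃, ε₃, hε₃, H3⟩ := all_minimisers_cube_reg910_full (n := n) hL
  refine ⟨C₀, C₁, C₂, C₃, hC₀, hC₁, hC₂, hC₃, min ε₁ (min ε₂ ε₃), lt_min hε₁ (lt_min hε₂ hε₃), fun ε hε hεle N _ hN => ?_⟩
  have hε1 : ε ≤ ε₁ := hεle.trans (min_le_left _ _)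
  have hε2 : ε ≤ ε₂ := hεle.trans ((min_le_right _ _).trans (min_le_left _ _))
  have hε3 : ε ≤ ε₃ := hεle.trans ((min_le_right _ _).trans (min_le_right _ _))
  obtain ⟨δ₁, hδ₁, K1⟩ := H1 ε hε hε1 N hN
  obtain ⟨δ₂, hδ₂, K2⟩ := H2 ε hε hε2 N hN
  obtain ⟨δ₃, hδ₃, K3⟩ := H3 ε hε hε3 N hN
  refine ⟨min δ₁ (min δ₂ δ₃), lt_min hδ₁ (lt_min hδ₂ hδ₃), fun V hV k => ?_⟩
  obtain ⟨hVu, hVp, hVs⟩ := hV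
  have hV1 : V ∈ {V : Site 4 → Fin 4 → (Matrix n n ℂ)ˣ | IsUnitaryCfg V ∧ IsPeriodicCfg V (N : ℤ) ∧ SmallField V δ₁} :=
    ⟨hVu, hVp, MinimalActionRate.SmallField.mono hVs (min_le_left _ _)⟩
  have hV2 : V ∈ {V : Site 4 → Fin 4 → (Matrix n n ℂ)ˣ | IsUnitaryCfg V ∧ IsPeriodicCfg V (N : ℤ) ∧ SmallField V δ₂} :=
    ⟨hVu, hVp, MinimalActionRate.SmallField.mono hVs ((min_le_right _ _).trans (min_le_left _ _))⟩
  have hV3 : V ∈ {V : Site 4 → Fin 4 → (Matrix n n ℂ)ˣ | IsUnitaryCfg V ∧ IsPeriodicCfg V (N : ℤ) ∧ SmallField V δ₃} :=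
    ⟨hVu, hVp, MinimalActionRate.SmallField.mono hVs ((min_le_right _ _).trans (min_le_right _ _))⟩
  exact ⟨K1 V hV1 k, K2 V hV2 k, fun U hU z => K3 V hV3 k U hU z⟩

end

end Summit.QuantumFields.BalabanUV.T4Continuum.NE7B11Thm1ForMinimisers
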